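import Summits.Ventures.CertifiedManyBodySolver.Theorems.M3x2EdgeSplitSymReplaySound
import HarnessLib

/-!
# BRIDGE: the registered VALUE stub `NearCertWardSlack_m83o100` (stmt-Ventures-22024, skeleton of record `Cruxes/LowerEdge_ge_m83o100/Lines/fo_dual_rounding.lean`, stub 3)
# FOLLOWS from a passing word-form certificate of value `≥ −83/100`

`nearCertWardSlack_of_symCert : symCheck K = true → (−83/100 : ℚ) ≤ symValue K → NearCertWardSlack_m83o100` — the symreplay chain
(T1–T10, `Theorems.M3x2EdgeSplitSymReplay*`) is a SUB-PROOF of the skeleton of record: its only open stub becomes «ship a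
`SymCert` literal of value ≥ −83/100 that the kernel / `native_decide` accepts».  The statement `NearCertWardSlack_m83o100` below is a VERBATIM copy of
the registered one (rfl-equal; both read through verbatim copies of wardk's `WardD4Identity`, here the landed
`WardSlot.WardD4Identity`).  The Gram of `WardD4CertGe` enters as ONE block with PSD floor `δ = 0` and weights `r i := ‖O i‖`
(L²-operator norm), the SOS norm certificates by hub-lb-dual-ref-2's G2′ C⋆-lemma.  NO certificate of value ≥ −83/100 exists in Lean
today; no bound of record moves; no summit or crux statement is proved here; nothing here predicts superconductivity.
-/

noncomputable section

namespace Summit.Ventures.CertifiedManyBodySolver.Theorems.SymReplay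

open Matrix Finset
open Literature.MathematicalPhysics.QuantumLattice
open Literature.MathematicalPhysics.QuantumLattice.HubbardWave0
open Literature.MathematicalPhysics.QuantumLattice.ThermodynamicLimit
open Literature.Probability.LatticeModels
open Literature.MathematicalPhysics.QuantumManyBody.StateRelaxation
open Summit.Ventures.CertifiedManyBodySolver.Theorems.WardSlot
open scoped ComplexOrder BigOperators

/-- **VERBATIM COPY of `FoDualRounding.NearCertWardSlack_m83o100`** (registered VALUE stub 3 of the skeleton of record). -/
def NearCertWardSlack_m83o100 : Prop :=
  ∃ (Λ Λ' : Finset (Site 2)) (hΛ : Λ ⊆ Λ') (_h8 : thicken Λ 1 ⊆ Λ')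
    (h0 : thicken ({0} : Finset (Site 2)) 1 ⊆ Λ') (hz : (0 : Site 2) ∈ Λ')
    (μ : ℝ)
    (nb : ℕ) (msz : Fin nb → ℕ) (Z : (k : Fin nb) → Matrix (Fin (msz k)) (Fin (msz k)) ℂ)
    (δs : Fin nb → ℝ) (_hδ : ∀ k, 0 ≤ δs k)
    (_hZ : ∀ k, (Z k + ((δs k : ℝ) : ℂ) • (1 : Matrix (Fin (msz k)) (Fin (msz k)) ℂ)).PosSemidef)
    (O : (k : Fin nb) → Fin (msz k) → FermionOp Λ') (r : (k : Fin nb) → Fin (msz k) → ℝ)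
    (_hO : ∀ k i, ((((r k i) ^ 2 : ℝ) : ℂ) • (1 : FermionOp Λ') - (O k i)ᴴ * O k i).PosSemidef)
    (ns : ℕ) (B : Fin ns → FermionOp Λ)
    (nt : ℕ) (γ : Fin nt → DihedralGroup 4) (wv : Fin nt → Site 2)
    (hsh : ∀ l, d4ShiftSet (γ l) (wv l) Λ ⊆ Λ') (Y : Fin nt → FermionOp Λ)
    (nu : ℕ) (b : Fin nu → ℂ) (cw : Fin nu → List (Orb (PolySite Λ') × Bool))
    (_hcw : ∀ j ∈ (Finset.univ : Finset (Fin nu)), ladderCharge (cw j) ≠ 0 ∨ ladderSpinCharge (cw j) ≠ 0)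
    (np : ℕ) (Xp : Fin np → FermionOp Λ') (nm' : ℕ) (Xm : Fin nm' → FermionOp Λ')
    (na : ℕ) (dc : Fin na → ℝ) (V : Fin na → FermionOp Λ')
    (nw : ℕ) (a : Fin nw → ℂ) (word : Fin nw → List (Orb (PolySite Λ') × Bool))
    (c : ℝ),
    WardD4Identity 1 0 8 (7 / 8) hΛ h0 hz μ (Matrix.blockDiagonal' Z)
      (fun p : (k : Fin nb) × Fin (msz k) => O p.1 p.2) Finset.univ B Finset.univ γ wv hsh Y Finset.univ b cw
      Finset.univ Xp Finset.univ Xm Finset.univ dc V Finset.univ a word c ∧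
    (-83 / 100 : ℝ) ≤ c - ∑ k, ‖a k‖ - ∑ k, δs k * ∑ i, (r k i) ^ 2

section G2prime
open scoped MatrixOrder Matrix.Norms.L2Operator

/-- **Norm bound ⇒ SOS form** (hub-lb-dual-ref-2, `pub/hub-lb/hub-lb-dual-ref-2/lean/G2prime.lean`, verbatim):
`‖A‖ ≤ r` in the L²-operator norm ⇒ `r² • 1 − Aᴴ A ⪰ 0`. -/
theorem posSemidef_sq_smul_one_sub_conjTranspose_mul_self {n : Type*} [Fintype n] [DecidableEq n]
    (A : Matrix n n ℂ) {r : ℝ} (h : ‖A‖ ≤ r) :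
    ((((r ^ 2 : ℝ)) : ℂ) • (1 : Matrix n n ℂ) - Aᴴ * A).PosSemidef := by
  letI : CStarAlgebra (Matrix n n ℂ) := {}
  have hsa : IsSelfAdjoint (Aᴴ * A) := by
    rw [← Matrix.star_eq_conjTranspose]
    exact IsSelfAdjoint.star_mul_self A
  have h1 : Aᴴ * A ≤ algebraMap ℝ (Matrix n n ℂ) ‖Aᴴ * A‖ := IsSelfAdjoint.le_algebraMap_norm_self hsa
  have halg : algebraMap ℝ (Matrix n n ℂ) ‖Aᴴ * A‖ = ((‖Aᴴ * A‖ : ℝ) : ℂ) • (1 : Matrix n n ℂ) := by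
    rw [Algebra.algebraMap_eq_smul_one]
    ext i j
    simp [Matrix.smul_apply, Complex.real_smul]
  rw [halg] at h1
  have hn : ‖Aᴴ * A‖ = ‖A‖ ^ 2 := by
    rw [← Matrix.star_eq_conjTranspose, CStarRing.norm_star_mul_self, sq]
  have h0 : 0 ≤ ‖A‖ := norm_nonneg A
  have hle : ‖Aᴴ * A‖ ≤ r ^ 2 := by
    rw [hn]
    nlinarith
  have h3 : ((‖Aᴴ * A‖ : ℝ) : ℂ) • (1 : Matrix n n ℂ) ≤ (((r ^ 2 : ℝ)) : ℂ) • (1 : Matrix n n ℂ) := by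
    rw [← sub_nonneg, ← sub_smul, ← Complex.ofReal_sub, Matrix.smul_one_eq_diagonal,
      Matrix.nonneg_iff_posSemidef]
    exact Matrix.posSemidef_diagonal_iff.2 fun _ => Complex.zero_le_real.2 (sub_nonneg.2 hle)
  rw [← Matrix.nonneg_iff_posSemidef, sub_nonneg]
  exact h1.trans h3

/-- **BRIDGE: a Ward × `D₄` window certificate of value `≥ -83 / 100` IS a near-certificate in the registered
stub's normal form** (one Gram block, `δ = 0`, `r i = ‖O i‖`). -/
theorem nearCertWardSlack_of_wardD4CertGe {q : ℝ} (h : WardD4CertGe q) (hq : (-83 / 100 : ℝ) ≤ q) :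
    NearCertWardSlack_m83o100 := by
  obtain ⟨Λ, Λ', hΛ, h8, h0, hz, μ, nm, Λm, hΛm, O, ns, B, nt, γ, wv, hsh, Y, nu, b, cw, hcw,
    np, Xp, nm', Xm, na, dc, V, nw, a, word, c, hcert, hval⟩ := h
  refine ⟨Λ, Λ', hΛ, h8, h0, hz, μ, 1, fun _ => nm, fun _ => Λm, fun _ => 0, fun _ => le_rfl, fun _ => ?_,
    fun _ i => O i, fun _ i => ‖O i‖, fun _ i => posSemidef_sq_smul_one_sub_conjTranspose_mul_self (O i) le_rfl,
    ns, B, nt, γ, wv, hsh, Y, nu, b, cw, hcw, np, Xp, nm', Xm, na, dc, V, nw, a, word, c, ?_, ?_⟩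
  · rw [Complex.ofReal_zero, zero_smul, add_zero]; exact hΛm
  · have hg : gramForm (Matrix.blockDiagonal' fun _ : Fin 1 => Λm)
        (fun p : (k : Fin 1) × Fin nm => (fun (_ : Fin 1) (i : Fin nm) => O i) p.1 p.2) = gramForm Λm O := by
      have h := gramForm_blockDiagonal' (Λ' := Λ') (fun _ : Fin 1 => Λm) (fun (_ : Fin 1) (i : Fin nm) => O i)
      rw [Fin.sum_univ_one] at h
      exact h
    unfold WardD4Identity at hcert ⊢
    rw [hg]
    exact hcert
  · simp only [zero_mul, Finset.sum_const_zero, sub_zero]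
    exact hq.trans hval

end G2prime

/-- **The registered VALUE stub of the skeleton of record follows from a passing `SymCert` of value
`≥ -83 / 100`** (S1–S4 + the bridge): the data stub S5 of this line closes stub 3 of `fo_dual_rounding`. -/
theorem nearCertWardSlack_of_symCert (K : SymCert) (hK : symCheck K = true) (hv : (-83 / 100 : ℚ) ≤ symValue K) :
    NearCertWardSlack_m83o100 :=
  nearCertWardSlack_of_wardD4CertGe
    (stub_soundOfKernels stub_nfFaithful stub_moveSound stub_dictionarySound K hK)
    (by exact_mod_cast hv)

end Summit.Ventures.CertifiedManyBodySolver.Theorems.SymReplay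

end
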